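import Summits.CriticalPhenomena.PercolationContinuityZ3.Theorems.PercNearOneGluingNoHeavyQuantFarTreeHubBlocksProfile
import HarnessLib

/-!
# QUANT lane R8, FAR on trees: the PROFILE CONJECTURE for 'hub + leaves + any root blocks' (typed), and the FAR row it implies

builds on p205010 (kernel theorem, internal audit signed; external expert review pending)

Statement + support file (`--supports stmt-CriticalPhenomena-4575`), QUANT lane typer seat prim-quant-stmt (gen 12); memo
`run/shared/lean/prim/quant/prim-quant-stmt-g12/MTL-PROFILE-LP.md`.  One `Prop` definition (an OPEN inequality family, `@[conjecture]`), theorems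
otherwise; no sorries; standard axioms.

* `Quant.HubBlocksProfileIneq` — **the profile conjecture (★)** of the memo, typed.  Data: gates `q` on `Fin n`, a finset `K` of BLOCK
  coordinates with sizes `size x` (block sum `W(ω) = Σ_{x ∈ K ∩ ω} size x`), a hub gate `G ∈ (0,1]`, a layer `j`, and an abstract HUB LAW `p` on
  `{0,…,m}` with mean `μ > 0` that is RATIO-REGULAR below the mean (`μ·p(b−1) ≤ b·p(b)` for `1 ≤ b ≤ μ`; every Poisson-binomial law is,
  `Quant.pb_ratio`).  Claim: if `2j < Σ_{x∈K} size x·q x + G·μ` then for every `τ ≤ μ/m` with `G·τ ≤ q x` on `K`,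
  `τ ≤ Σ_{b ≤ m} p b·( P(W ≥ j+1−b) + ((1−G)/G)·P(W ≥ j+1) )`.
  Status: OPEN.  Evidence: it is equivalent to the vertex inequalities `(V_{t,b₁})` (hub laws = Poisson(μ)-shape on `[t,⌊μ⌋]` ⊕ atom `b₁`;
  `Quant.ratioRegular_expectation_ge_of_vertices`), exact census 306 000 / 0 violations (memo §6–§7); the `K = ∅` case is
  `Quant.pb_smallBall_avg`'s ratio-regular form (memo §3, proved); law-level relaxation of `W` is FALSE (memo §7), so `W` must stay a product.
* `Quant.farTree_hubBlocks_of_hubBlocksProfileIneq` — **the conjecture implies FAR at EVERY layer for 'hub (any gate) + leaf relays (any gates,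
  glued hub relays = gate-1 leaves) + ANY number of root blocks (any sizes, any gates)'** in the gate vocabulary of `Quant.tree_relayCount_transfer`,
  in the standard shape of `Quant.farTree_hubBlocks_commonGate`: `2j < Σ_a P(a reached)` and `1 − P(a reached) ≤ t` on `A` give `P(#{a ∈ A counted} ≤ j) ≤ t`
  (via `Quant.farTree_hubBlocks_of_profile`, `Quant.pb_ratio`, `Quant.pb_mean`, `Quant.pb_levels_sum_one`) — indeed with the AVERAGE leaf gate.
[cite: KozmaNitzan2024, Conjecture 3 (p. 15)] (the gluing rows served); [this work].
-/

noncomputable section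

namespace Summit.CriticalPhenomena.PercolationContinuityZ3.Theorems

namespace Quant

open Finset MeasureTheory
open Literature.Probability.LatticeModels
open Literature.Probability.Percolation
open scoped Classical

/-- **The profile conjecture (★) for 'hub + leaves + root blocks'.**  For gates `q` on `Fin n`, block coordinates `K` with sizes `size`, a hub
gate `0 < G ≤ 1`, a layer `j`, and every law `p` on `{0,…,m}` (`p ≥ 0`, `Σ p = 1`) with mean `μ > 0` that is ratio-regular below the mean
(`μ·p(b−1) ≤ b·p(b)` for `1 ≤ b ≤ μ`): if `2j < Σ_{x∈K} size x·q x + G·μ` then every `τ ≤ μ/m` with `G·τ ≤ q x` (`x ∈ K`) satisfies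
`τ ≤ Σ_{b ≤ m} p b·(P(W ≥ j+1−b) + ((1−G)/G)·P(W ≥ j+1))`, `W(ω) = Σ_{x ∈ K ∩ ω} size x`.  OPEN (census 306 000 / 0; memo MTL-PROFILE-LP.md).
[status: open] [this work] -/
@[conjecture] def HubBlocksProfileIneq : Prop :=
  ∀ (n : ℕ) (q : Fin n → unitInterval) (K : Finset (Fin n)) (size : Fin n → ℕ) (m : ℕ) (p : ℕ → ℝ) (μ G τ : ℝ) (j : ℕ),
    (∀ b, 0 ≤ p b) →
    (∑ b ∈ Finset.range (m + 1), p b = 1) →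
    (∑ b ∈ Finset.range (m + 1), (b : ℝ) * p b = μ) →
    0 < μ →
    (∀ b : ℕ, 1 ≤ b → (b : ℝ) ≤ μ → μ * p (b - 1) ≤ (b : ℝ) * p b) →
    0 < G → G ≤ 1 →
    (2 * j : ℝ) < (∑ x ∈ K, (size x : ℝ) * (q x : ℝ)) + G * μ →
    τ ≤ μ / m →
    (∀ x ∈ K, G * τ ≤ (q x : ℝ)) →
    τ ≤ ∑ b ∈ Finset.range (m + 1), p b *
      ((prodBernoulli q).real {ω : Set (Fin n) | j + 1 - b ≤ ∑ x ∈ K.filter (fun x => x ∈ ω), size x} +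
        (1 - G) / G * (prodBernoulli q).real {ω : Set (Fin n) | j + 1 ≤ ∑ x ∈ K.filter (fun x => x ∈ ω), size x})

variable {n : ℕ}

/-- **The profile conjecture implies FAR at every layer for 'hub + leaves + ANY root blocks'.**  Setting of `Quant.farTree_hubBlocks`
(observer `o`; hub `h`; leaf relays `L`, parent `h`; block vertices `K`, parent `o`, with gate-`1` tails `B b`; relays
`A = L ∪ ⋃_{b∈K}({b} ∪ B b)`; no regime, no common gate).  If `2j < q h·Σ_{ℓ∈L} q ℓ + Σ_{b∈K} q b·(|B b|+1)` (`= Σ_{a∈A} P(a reached)`) and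
`1 − q b ≤ t` on `K`, `1 − q h·q ℓ₀ ≤ t` for a least reliable leaf `ℓ₀`, then `P(#{a ∈ A counted} ≤ j) ≤ t`. [this work] -/
theorem farTree_hubBlocks_of_hubBlocksProfileIneq (hP : HubBlocksProfileIneq) (q : Fin n → unitInterval) (o h ℓ₀ : Fin n)
    (L K : Finset (Fin n)) (B : Fin n → Finset (Fin n)) (depth : Fin n → ℕ) (par : Fin n → Fin n) (j : ℕ) (t : ℝ)
    (hK : ∀ b ∈ K, par b = o ∧ depth b = 0)
    (hL : ∀ a ∈ L, par a = h ∧ depth a = 1) (hB : ∀ b ∈ K, ∀ a ∈ B b, par a = b ∧ depth a = 1)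
    (hhL : h ∉ L) (hhK : h ∉ K) (hLK : Disjoint L K) (hLB : ∀ b ∈ K, Disjoint L (B b))
    (hKB : ∀ b ∈ K, ∀ b' ∈ K, b ∉ B b') (hBB : ∀ b ∈ K, ∀ b' ∈ K, b ≠ b' → Disjoint (B b) (B b'))
    (hqB : ∀ b ∈ K, ∀ a ∈ B b, q a = 1) (hℓ₀ : ℓ₀ ∈ L) (hmin : ∀ a ∈ L, (q ℓ₀ : ℝ) ≤ q a) (hqℓ₀ : 0 < (q ℓ₀ : ℝ))
    (hEN : (2 * j : ℝ) < (q h : ℝ) * ∑ a ∈ L, (q a : ℝ) + ∑ b ∈ K, (q b : ℝ) * (((B b).card : ℝ) + 1))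
    (htK : ∀ b ∈ K, 1 - (q b : ℝ) ≤ t) (htℓ : 1 - (q h : ℝ) * q ℓ₀ ≤ t) :
    (prodBernoulli q).real {ω' : Set (Fin n) |
      ((L ∪ K.biUnion fun b => insert b (B b)).filter
        fun a => a = o ∨ ∀ i, i ≤ depth a → par^[i] a ∈ ω').card ≤ j} ≤ t := by
  set μ := prodBernoulli q with hμ
  set U : ℝ := ∑ a ∈ L, (q a : ℝ) with hU
  set G : ℝ := (q h : ℝ) with hG
  have hG1 : G ≤ 1 := (q h).2.2
  have hL0 : 0 < L.card := Finset.card_pos.2 ⟨ℓ₀, hℓ₀⟩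
  have hUpos : 0 < U := by
    have : (q ℓ₀ : ℝ) ≤ U := by
      rw [hU]; exact Finset.single_le_sum (fun a _ => (q a).2.1) hℓ₀
    linarith
  -- degenerate hub gate: then the leaf `ℓ₀` has marginal `0` and `t ≥ 1`
  rcases eq_or_lt_of_le (q h).2.1 with hG0 | hGpos
  · have ht1 : 1 ≤ t := by
      have hG0' : G = 0 := by rw [hG]; exact hG0.symm
      rw [hG0', zero_mul, sub_zero] at htℓ
      exact htℓ
    exact measureReal_le_one.trans ht1
  have hGpos' : 0 < G := hGpos
  -- Choose `τ` as the minimum of `U/|L|` and the block ratios `q b / G` over `K` (a finite minimum).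
  obtain ⟨τ, hτU, hτK, hτt⟩ : ∃ τ : ℝ, τ ≤ U / L.card ∧ (∀ b ∈ K, G * τ ≤ (q b : ℝ)) ∧ 1 - G * τ ≤ t := by
    rcases K.eq_empty_or_nonempty with hKe | hKne
    · refine ⟨U / L.card, le_rfl, fun b hb => by rw [hKe] at hb; exact absurd hb (Finset.notMem_empty b), ?_⟩
      -- `G · U/|L| ≥ G · q ℓ₀`
      have havg : (q ℓ₀ : ℝ) ≤ U / L.card := by
        rw [le_div_iff₀ (by exact_mod_cast hL0), hU]
        have : ∑ a ∈ L, (q ℓ₀ : ℝ) ≤ ∑ a ∈ L, (q a : ℝ) := Finset.sum_le_sum hmin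
        rw [Finset.sum_const, nsmul_eq_mul] at this
        linarith
      have : G * (q ℓ₀ : ℝ) ≤ G * (U / L.card) := mul_le_mul_of_nonneg_left havg hGpos'.le
      linarith
    · obtain ⟨b₀, hb₀, hb₀min⟩ := Finset.exists_min_image K (fun b => (q b : ℝ)) hKne
      refine ⟨min (U / L.card) ((q b₀ : ℝ) / G), min_le_left _ _, fun b hb => ?_, ?_⟩
      · calc G * min (U / L.card) ((q b₀ : ℝ) / G) ≤ G * ((q b₀ : ℝ) / G) :=
            mul_le_mul_of_nonneg_left (min_le_right _ _) hGpos'.le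
          _ = (q b₀ : ℝ) := by field_simp
          _ ≤ (q b : ℝ) := hb₀min b hb
      · -- `1 − G·min(U/|L|, q b₀/G) ≤ max(1 − G·U/|L|, 1 − q b₀) ≤ t`
        rcases le_total (U / L.card) ((q b₀ : ℝ) / G) with hc | hc
        · rw [min_eq_left hc]
          have havg : (q ℓ₀ : ℝ) ≤ U / L.card := by
            rw [le_div_iff₀ (by exact_mod_cast hL0), hU]
            have : ∑ a ∈ L, (q ℓ₀ : ℝ) ≤ ∑ a ∈ L, (q a : ℝ) := Finset.sum_le_sum hmin
            rw [Finset.sum_const, nsmul_eq_mul] at this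
            linarith
          have : G * (q ℓ₀ : ℝ) ≤ G * (U / L.card) := mul_le_mul_of_nonneg_left havg hGpos'.le
          linarith
        · rw [min_eq_right hc]
          have : G * ((q b₀ : ℝ) / G) = (q b₀ : ℝ) := by field_simp
          rw [this]
          exact htK b₀ hb₀
  -- the hub law: `P(X = b)`, ratio-regular with mean `U`
  set P : ℕ → ℝ := fun b => μ.real {ω : Set (Fin n) | (L.filter fun x => x ∈ ω).card = b} with hPdef
  have hp0 : ∀ b, 0 ≤ P b := fun b => measureReal_nonneg
  have hsum : ∑ b ∈ Finset.range (L.card + 1), P b = 1 := pb_levels_sum_one q L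
  have hmean : ∑ b ∈ Finset.range (L.card + 1), (b : ℝ) * P b = U := pb_mean q L
  have hratio : ∀ b : ℕ, 1 ≤ b → (b : ℝ) ≤ U → U * P (b - 1) ≤ (b : ℝ) * P b := fun b hb1 hbU => pb_ratio q L b hb1 hbU
  -- the mean hypothesis in the conjecture's shape
  have hEN' : (2 * j : ℝ) < (∑ x ∈ K, (((fun b => (B b).card + 1) x : ℕ) : ℝ) * (q x : ℝ)) + G * U := by
    have e : ∑ x ∈ K, (((fun b => (B b).card + 1) x : ℕ) : ℝ) * (q x : ℝ) = ∑ b ∈ K, (q b : ℝ) * (((B b).card : ℝ) + 1) := by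
      refine Finset.sum_congr rfl fun b _ => ?_
      push_cast; ring
    rw [e, hG, hU]; linarith
  have hmain := hP n q K (fun b => (B b).card + 1) L.card P U G τ j hp0 hsum hmean hUpos hratio hGpos' hG1 hEN' hτU hτK
  have hbound := farTree_hubBlocks_of_profile q o h L K B depth par j τ hK hL hB hhL hhK hLK hLB hKB hBB hqB hGpos' hmain
  exact hbound.trans hτt

end Quant

end Summit.CriticalPhenomena.PercolationContinuityZ3.Theorems
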